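import Literature.Topology.FourManifolds.LatticeFormsPolarisationTypesOrientedOrbits
import Literature.Topology.FourManifolds.LatticeFormsNegTwoDVectorOrbitCount
import HarnessLib

/-!
# `(−2)`- and `(−2d)`-vector orbits under `O⁺(II_{2,8m+2})` and `Õ⁺(L_{2d}^{(m)})` — GHS Prop. 2.4 with the printed groups
# (Gritsenko–Hulek–Sankaran, *Hirzebruch–Mumford proportionality and locally symmetric varieties of orthogonal type*,
# Doc. Math. 13 (2008), Prop. 2.4 (i), (ii), (iv))

Trunk T-4MAN vocabulary; sequel of `LatticeFormsNegTwoVectorOrbits.lean` (row g41-#1: Prop. 2.4 (i)–(ii) for `O` and `Õ`),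
`LatticeFormsNegTwoDVectorOrbitCount.lean` (row g41-#2: Prop. 2.4 (iv) for `Õ`) and `LatticeFormsPolarisationTypesOrientedOrbits.lean`
(rows g46-#4, #6: the `O⁺`-condition is free on orbits as soon as the vector has an orthogonal `(+2)`-vector, which two
orthogonal hyperbolic planes always supply). Written for lane `lit-hodgefound` (Track 2 foundations; prover seat
`lit-hodgefound-p18`, gen 46, row g46-#9). THEOREMS ONLY — no definition, no named fact, no instance, no notation.

The predecessor files carry the printed statements for the groups WITHOUT the spinor-norm condition and say so
("TODO(general form): `Õ⁺` (no spinor norm ∕ orientation character in the tree)"). The orientation character is now in the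
tree (`LinearMap.BilinForm.IsometryEquiv.IsOrientationPreserving`, rows g46-#1, #2), and this file discharges those TODOs:
every statement of Prop. 2.4 (i), (ii), (iv) holds verbatim for `O⁺(II_{2,8m+2})`, `O⁺(L)`, `Õ⁺(L)`, `L = B₀ ⊕ ⟨−2d⟩` with
`B₀` even unimodular containing two orthogonal hyperbolic planes, in particular for `L_{2d}^{(m)} = 2U ⊕ mE₈(−1) ⊕ ⟨−2d⟩`.

## Source, verbatim (Doc. Math. 13 (2008) 1–19, §2 "The branch divisors", held text `paper:arxiv-math_0609774` pp. 5–6)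

"**Proposition 2.4.** Suppose `d` is a positive integer. (i) Any two `(−2)`-vectors in the lattice `II_{2,8m+2}` are
equivalent modulo `O⁺(II_{2,8m+2})` […] (ii) There is one `Õ⁺(L_{2d}^{(m)})`-orbit of `(−2)`-vectors `r` in `L_{2d}^{(m)}`
with `div(r) = 1`. If `d ≡ 1 mod 4` then there is a second orbit of `(−2)`-vectors, with `div(r) = 2`. […] (iv) Suppose
`d > 1`. The number of `Õ(L_{2d}^{(m)})`-orbits of `(−2d)`-vectors with `div(r) = 2d` is `2^{ρ(d)}`. The number of
`Õ(L_{2d}^{(m)})`-orbits of `(−2d)`-vectors with `div(r) = d` is `2^{ρ(d)}` if `d` is odd or `d ≡ 4 mod 8`; `2^{ρ(d)+1}` if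
`d ≡ 0 mod 8`; `2^{ρ(d)−1}` if `d ≡ 2 mod 4`. […] *Proof.* If the lattice `L` contains two hyperbolic planes then according
to the well-known result of Eichler (see [E]) the `Õ⁺(L)`-orbit of a primitive vector `l ∈ L` is completely defined by two
invariants: by its length `(l,l)` and by its image `l* + L` in the discriminant group `A_L`".

## Contents (all proved; each statement is the predecessor's with the `O⁺`-condition added, same count)

* §1 Prop. 2.4 (i) for `O⁺`: `exists_isometryEquiv_isOrientationPreserving_apply_eq_of_apply_self_eq_neg_two`,
  `natCard_quot_isometryEquiv_isOrientationPreserving_apply_self_eq_neg_two_of_isUnimodular` (one `O⁺`-orbit of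
  `(−2)`-vectors in a symmetric even unimodular lattice with `n± ≥ 2`).
* §2 Prop. 2.4 (ii) in `L = B₀ ⊕ ⟨−2d⟩` for `Õ⁺` and `O⁺`: the two criteria (`div = 1`, `div = 2`) and the counts
  `if d % 4 = 1 then 2 else 1`.
* §3 Prop. 2.4 (iv) for `Õ⁺`: `2^{ρ(d)}` orbits of `(−2d)`-vectors with `div = 2d`; `#{x mod d : x² = 1}` with `div = d`.
* §4 The models `L_{2d}^{(m)} = (E₈(−1)^{⊕m} ⊕ U^{⊕2}) ⊕ ℤ(−2d)`.

## References

* [GritsenkoHulekSankaran2008Proportionality] V. Gritsenko, K. Hulek, G. K. Sankaran, Hirzebruch–Mumford proportionality and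
  locally symmetric varieties of orthogonal type, Doc. Math. 13 (2008) 1–19 (arXiv:math/0609774): Prop. 2.4 (i), (ii), (iv).
* [GritsenkoHulekSankaran2009] V. Gritsenko, K. Hulek, G. K. Sankaran, Abelianisation of orthogonal groups and the fundamental
  group of modular varieties, J. Algebra 322 (2009): §3.3 ("`E(L)` is a subgroup of `S̃O⁺(L)`").
* [Huybrechts2016K3] D. Huybrechts, Lectures on K3 Surfaces, Ch. 7 §5.4 (`O⁺`, spinor norm of reflections) and Ch. 14 Cor. 1.10.
-/

noncomputable section

open Module Function
open LinearMap (BilinForm)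
open LinearMap.BilinForm

namespace Literature.Topology.FourManifolds

universe u

/-! ### §1 Prop. 2.4 (i) with `O⁺`: one `O⁺`-orbit of `(−2)`-vectors in an even unimodular lattice with `n± ≥ 2` -/

section Unimodular

variable {V : Type u} [AddCommGroup V] [Module.Finite ℤ V] [Module.Free ℤ V] (Q : BilinForm ℤ V)

/-- **Prop. 2.4 (i): "Any two `(−2)`-vectors in the lattice `II_{2,8m+2}` are equivalent modulo `O⁺(II_{2,8m+2})`"** — for
every symmetric even unimodular lattice with `n± ≥ 2`: the `O`-statement of `LatticeFormsNegTwoVectorOrbits` upgraded by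
`σ_u`, `u ⊥ r` a `(+2)`-vector in two orthogonal hyperbolic planes.
[cite: GritsenkoHulekSankaran2008Proportionality, Prop. 2.4 (i)] [cite: Huybrechts2016K3, Ch. 14 Cor. 1.10 and Ch. 7 §5.4] -/
theorem exists_isometryEquiv_isOrientationPreserving_apply_eq_of_apply_self_eq_neg_two (hs : Q.IsSymm)
    (hu : Q.IsUnimodular) (he : Q.IsEven) (h2 : 2 ≤ sigPos Q.toQuadraticMap) (h2' : 2 ≤ sigNeg Q.toQuadraticMap)
    {r s : V} (hr : Q r r = -2) (hs' : Q s s = -2) :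
    ∃ φ : Q.IsometryEquiv Q, φ.IsOrientationPreserving ∧ φ r = s := by
  obtain ⟨x, y, x₁, y₁, hP⟩ := exists_twoHyperbolicPairs_of_isEven_of_isUnimodular Q hs hu he h2 h2'
  obtain ⟨w, hww, hwr⟩ := hP.exists_apply_self_eq_two_apply_eq_zero r
  have h1 := exists_isometryEquiv_isOrientationPreserving_iff_of_ortho hs hu.nondegenerate hww hwr (fun _ ↦ True)
    (h' := s)
  simp only [true_and] at h1
  exact h1.2 (exists_isometryEquiv_apply_eq_of_apply_self_eq_neg_two Q hs hu he h2 h2' hr hs')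

/-- **Prop. 2.4 (i), one `O⁺`-orbit**: the `(−2)`-vectors of a symmetric even unimodular lattice with `n± ≥ 2` form a
single `O⁺`-orbit. [cite: GritsenkoHulekSankaran2008Proportionality, Prop. 2.4 (i)] [cite: Huybrechts2016K3, Ch. 14 Cor. 1.10] -/
theorem natCard_quot_isometryEquiv_isOrientationPreserving_apply_self_eq_neg_two_of_isUnimodular (hs : Q.IsSymm)
    (hu : Q.IsUnimodular) (he : Q.IsEven) (h2 : 2 ≤ sigPos Q.toQuadraticMap) (h2' : 2 ≤ sigNeg Q.toQuadraticMap) :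
    Nat.card (Quot fun r s : {r : V // Q r r = -2} ↦
      ∃ φ : Q.IsometryEquiv Q, φ.IsOrientationPreserving ∧ φ r.1 = s.1) = 1 := by
  obtain ⟨x, y, x₁, y₁, hP⟩ := exists_twoHyperbolicPairs_of_isEven_of_isUnimodular Q hs hu he h2 h2'
  refine Eq.trans (Nat.card_congr (Quot.congrRight fun r s ↦ ?_))
    (natCard_quot_isometryEquiv_apply_self_eq_neg_two_of_isUnimodular Q hs hu he h2 h2')
  obtain ⟨w, hww, hwr⟩ := hP.exists_apply_self_eq_two_apply_eq_zero r.1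
  have h1 := exists_isometryEquiv_isOrientationPreserving_iff_of_ortho hs hu.nondegenerate hww hwr (fun _ ↦ True)
    (h' := s.1)
  simpa only [true_and] using h1

end Unimodular

/-! ### §2 Prop. 2.4 (ii) with `Õ⁺` and `O⁺` in `L = B₀ ⊕ ⟨−2d⟩` -/

section Abstract

variable {M : Type u} [AddCommGroup M] [Module.Finite ℤ M] [Module.Free ℤ M] {B₀ : BilinForm ℤ M} (d : ℕ)

/-- **Prop. 2.4 (ii), `div = 1`: "There is one `Õ⁺(L_{2d}^{(m)})`-orbit of `(−2)`-vectors `r` … with `div(r) = 1`"** — two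
`(−2)`-vectors of `L = B₀ ⊕ ⟨−2d⟩` admitting dual vectors `(u, u') = (v, v') = 1` are exchanged by an ORIENTATION-PRESERVING
isometry acting trivially on `A_L`. [cite: GritsenkoHulekSankaran2008Proportionality, Prop. 2.4 (ii)] [cite: GritsenkoHulekSankaran2009, §3.3] -/
theorem exists_isometryEquiv_isOrientationPreserving_apply_eq_of_apply_self_eq_neg_two_of_apply_eq_one
    (hu : B₀.IsUnimodular) (he : B₀.IsEven) (hd : 0 < d) {x y x₁ y₁ : M} (h : TwoHyperbolicPairs B₀ x y x₁ y₁)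
    {u v u' v' : M × ℤ} (huu : B₀.prod ((-(2 * d : ℤ)) • LinearMap.mul ℤ ℤ) u u = -2)
    (hvv : B₀.prod ((-(2 * d : ℤ)) • LinearMap.mul ℤ ℤ) v v = -2)
    (hu' : B₀.prod ((-(2 * d : ℤ)) • LinearMap.mul ℤ ℤ) u u' = 1)
    (hv' : B₀.prod ((-(2 * d : ℤ)) • LinearMap.mul ℤ ℤ) v v' = 1) :
    ∃ g : (B₀.prod ((-(2 * d : ℤ)) • LinearMap.mul ℤ ℤ)).IsometryEquiv (B₀.prod ((-(2 * d : ℤ)) • LinearMap.mul ℤ ℤ)),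
      g.discriminantGroupCongr = LinearEquiv.refl ℤ _ ∧ g.IsOrientationPreserving ∧ g u = v :=
  (exists_isometryEquiv_isOrientationPreserving_apply_eq_iff d hu hd h (fun φ ↦ φ = LinearEquiv.refl ℤ _) u v).2
    (exists_isometryEquiv_apply_eq_of_apply_self_eq_neg_two_of_apply_eq_one d hu he hd h huu hvv hu' hv')

/-- **Prop. 2.4 (ii), `div = 2`: "a second orbit of `(−2)`-vectors, with `div(r) = 2`"** — two `(−2)`-vectors of `L` with
even products are exchanged by an orientation-preserving isometry acting trivially on `A_L`.
[cite: GritsenkoHulekSankaran2008Proportionality, Prop. 2.4 (ii)] [cite: GritsenkoHulekSankaran2009, §3.3] -/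
theorem exists_isometryEquiv_isOrientationPreserving_apply_eq_of_apply_self_eq_neg_two_of_forall_two_dvd
    (hu : B₀.IsUnimodular) (he : B₀.IsEven) (hd : 0 < d) {x y x₁ y₁ : M} (h : TwoHyperbolicPairs B₀ x y x₁ y₁)
    {u v : M × ℤ} (huu : B₀.prod ((-(2 * d : ℤ)) • LinearMap.mul ℤ ℤ) u u = -2)
    (hvv : B₀.prod ((-(2 * d : ℤ)) • LinearMap.mul ℤ ℤ) v v = -2)
    (h2u : ∀ z, (2 : ℤ) ∣ B₀.prod ((-(2 * d : ℤ)) • LinearMap.mul ℤ ℤ) u z)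
    (h2v : ∀ z, (2 : ℤ) ∣ B₀.prod ((-(2 * d : ℤ)) • LinearMap.mul ℤ ℤ) v z) :
    ∃ g : (B₀.prod ((-(2 * d : ℤ)) • LinearMap.mul ℤ ℤ)).IsometryEquiv (B₀.prod ((-(2 * d : ℤ)) • LinearMap.mul ℤ ℤ)),
      g.discriminantGroupCongr = LinearEquiv.refl ℤ _ ∧ g.IsOrientationPreserving ∧ g u = v :=
  (exists_isometryEquiv_isOrientationPreserving_apply_eq_iff d hu hd h (fun φ ↦ φ = LinearEquiv.refl ℤ _) u v).2
    (exists_isometryEquiv_apply_eq_of_apply_self_eq_neg_two_of_forall_two_dvd d hu he hd h huu hvv h2u h2v)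

/-- **Prop. 2.4 (ii), the orbit count under `Õ⁺(L)`**: the `(−2)`-vectors of `L = B₀ ⊕ ⟨−2d⟩` form two `Õ⁺(L)`-orbits if
`d ≡ 1 (mod 4)` and one otherwise — the printed statement, now with its group.
[cite: GritsenkoHulekSankaran2008Proportionality, Prop. 2.4 (ii)] -/
theorem natCard_quot_stable_isometryEquiv_isOrientationPreserving_apply_self_eq_neg_two (hu : B₀.IsUnimodular)
    (he : B₀.IsEven) (hd : 0 < d) {x y x₁ y₁ : M} (h : TwoHyperbolicPairs B₀ x y x₁ y₁) :
    Nat.card (Quot fun r s : {r : M × ℤ // B₀.prod ((-(2 * d : ℤ)) • LinearMap.mul ℤ ℤ) r r = -2} ↦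
      ∃ g : (B₀.prod ((-(2 * d : ℤ)) • LinearMap.mul ℤ ℤ)).IsometryEquiv (B₀.prod ((-(2 * d : ℤ)) • LinearMap.mul ℤ ℤ)),
        g.discriminantGroupCongr = LinearEquiv.refl ℤ _ ∧ g.IsOrientationPreserving ∧ g r.1 = s.1) =
      if d % 4 = 1 then 2 else 1 :=
  Eq.trans (Nat.card_congr (Quot.congrRight fun r s ↦
      exists_isometryEquiv_isOrientationPreserving_apply_eq_iff d hu hd h (fun φ ↦ φ = LinearEquiv.refl ℤ _) r.1 s.1))
    (natCard_quot_stable_isometryEquiv_apply_self_eq_neg_two d hu he hd h)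

/-- **Prop. 2.4 (ii), the orbit count under `O⁺(L)`**: two `O⁺(L)`-orbits of `(−2)`-vectors if `d ≡ 1 (mod 4)` (divisors
`1` and `2`), one otherwise. [cite: GritsenkoHulekSankaran2008Proportionality, Prop. 2.4 (ii)] -/
theorem natCard_quot_isometryEquiv_isOrientationPreserving_apply_self_eq_neg_two (hu : B₀.IsUnimodular)
    (he : B₀.IsEven) (hd : 0 < d) {x y x₁ y₁ : M} (h : TwoHyperbolicPairs B₀ x y x₁ y₁) :
    Nat.card (Quot fun r s : {r : M × ℤ // B₀.prod ((-(2 * d : ℤ)) • LinearMap.mul ℤ ℤ) r r = -2} ↦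
      ∃ g : (B₀.prod ((-(2 * d : ℤ)) • LinearMap.mul ℤ ℤ)).IsometryEquiv (B₀.prod ((-(2 * d : ℤ)) • LinearMap.mul ℤ ℤ)),
        g.IsOrientationPreserving ∧ g r.1 = s.1) =
      if d % 4 = 1 then 2 else 1 := by
  refine Eq.trans (Nat.card_congr (Quot.congrRight fun r s ↦ ?_))
    (natCard_quot_isometryEquiv_apply_self_eq_neg_two d hu he hd h)
  have h1 := exists_isometryEquiv_isOrientationPreserving_apply_eq_iff d hu hd h (fun _ ↦ True) r.1 s.1
  simpa only [true_and] using h1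

/-! ### §3 Prop. 2.4 (iv) with `Õ⁺`: `(−2d)`-vectors with `div = 2d` and `div = d` -/

/-- **Prop. 2.4 (iv), `div(r) = 2d`, for `Õ⁺(L)`**: `2^{ρ(d)}` orbits of `(−2d)`-vectors `r` with `(r, L) = 2dℤ` in
`L = B₀ ⊕ ⟨−2d⟩` under the orientation-preserving isometries acting trivially on `A_L`.
[cite: GritsenkoHulekSankaran2008Proportionality, Prop. 2.4 (iv)] -/
theorem natCard_quot_stable_isometryEquiv_isOrientationPreserving_neg_twoMul_of_divisor_twoMul (hu : B₀.IsUnimodular)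
    (he : B₀.IsEven) (hd : 0 < d) {x y x₁ y₁ : M} (h : TwoHyperbolicPairs B₀ x y x₁ y₁) :
    Nat.card (Quot fun r s : {r : M × ℤ // B₀.prod ((-(2 * d : ℤ)) • LinearMap.mul ℤ ℤ) r r = -(2 * d : ℤ) ∧
        (∀ z, (2 * d : ℤ) ∣ B₀.prod ((-(2 * d : ℤ)) • LinearMap.mul ℤ ℤ) r z) ∧
          ∃ r', B₀.prod ((-(2 * d : ℤ)) • LinearMap.mul ℤ ℤ) r r' = 2 * d} ↦
      ∃ g : (B₀.prod ((-(2 * d : ℤ)) • LinearMap.mul ℤ ℤ)).IsometryEquiv (B₀.prod ((-(2 * d : ℤ)) • LinearMap.mul ℤ ℤ)),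
        g.discriminantGroupCongr = LinearEquiv.refl ℤ _ ∧ g.IsOrientationPreserving ∧ g r.1 = s.1) =
      2 ^ d.primeFactors.card :=
  Eq.trans (Nat.card_congr (Quot.congrRight fun r s ↦
      exists_isometryEquiv_isOrientationPreserving_apply_eq_iff d hu hd h (fun φ ↦ φ = LinearEquiv.refl ℤ _) r.1 s.1))
    (natCard_quot_stable_isometryEquiv_neg_twoMul_of_divisor_twoMul d hu he hd h)

/-- **Prop. 2.4 (iv), `div(r) = d`, for `Õ⁺(L)`**: the orbits of `(−2d)`-vectors `r` with `(r, L) = dℤ` under the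
orientation-preserving isometries acting trivially on `A_L` number `#{x mod d : x² = 1}` (evaluated by cases on `d` in
`LatticeFormsNegTwoDVectorOrbitCount` §4). [cite: GritsenkoHulekSankaran2008Proportionality, Prop. 2.4 (iv)] -/
theorem natCard_quot_stable_isometryEquiv_isOrientationPreserving_neg_twoMul_of_divisor (hu : B₀.IsUnimodular)
    (he : B₀.IsEven) (hd : 0 < d) {x y x₁ y₁ : M} (h : TwoHyperbolicPairs B₀ x y x₁ y₁) :
    Nat.card (Quot fun r s : {r : M × ℤ // B₀.prod ((-(2 * d : ℤ)) • LinearMap.mul ℤ ℤ) r r = -(2 * d : ℤ) ∧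
        (∀ z, (d : ℤ) ∣ B₀.prod ((-(2 * d : ℤ)) • LinearMap.mul ℤ ℤ) r z) ∧
          ∃ r', B₀.prod ((-(2 * d : ℤ)) • LinearMap.mul ℤ ℤ) r r' = d} ↦
      ∃ g : (B₀.prod ((-(2 * d : ℤ)) • LinearMap.mul ℤ ℤ)).IsometryEquiv (B₀.prod ((-(2 * d : ℤ)) • LinearMap.mul ℤ ℤ)),
        g.discriminantGroupCongr = LinearEquiv.refl ℤ _ ∧ g.IsOrientationPreserving ∧ g r.1 = s.1) =
      Nat.card {u : ZMod d // u ^ 2 = 1} :=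
  Eq.trans (Nat.card_congr (Quot.congrRight fun r s ↦
      exists_isometryEquiv_isOrientationPreserving_apply_eq_iff d hu hd h (fun φ ↦ φ = LinearEquiv.refl ℤ _) r.1 s.1))
    (natCard_quot_stable_isometryEquiv_neg_twoMul_of_divisor d hu he hd h)

end Abstract

/-! ### §4 The models `L_{2d}^{(m)} = (E₈(−1)^{⊕m} ⊕ U^{⊕2}) ⊕ ℤ(−2d)` (`m = 2`: the K3 lattice `L_{2d}`) -/

section Model

variable (m d : ℕ)

/-- **Prop. 2.4 (ii) for `L_{2d}^{(m)}`, `Õ⁺`-orbits, as printed**: "There is one `Õ⁺(L_{2d}^{(m)})`-orbit of `(−2)`-vectors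
`r` in `L_{2d}^{(m)}` with `div(r) = 1`. If `d ≡ 1 mod 4` then there is a second orbit of `(−2)`-vectors, with `div(r) = 2`."
[cite: GritsenkoHulekSankaran2008Proportionality, Prop. 2.4 (ii)] -/
theorem natCard_quot_stable_isometryEquiv_isOrientationPreserving_latticeL2dm_apply_self_eq_neg_two (hd : 0 < d) :
    Nat.card (Quot fun r s : {r : ((Fin m → Fin 8 → ℤ) × ((Fin 2 → ℤ) × (Fin 2 → ℤ))) × ℤ //
        (((LinearMap.BilinForm.pi fun _ : Fin m ↦ -e8Form).prod (hyperbolicSum 2)).prod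
          ((-(2 * d : ℤ)) • LinearMap.mul ℤ ℤ)) r r = -2} ↦
      ∃ g : ((((LinearMap.BilinForm.pi fun _ : Fin m ↦ -e8Form).prod (hyperbolicSum 2)).prod
          ((-(2 * d : ℤ)) • LinearMap.mul ℤ ℤ))).IsometryEquiv
          ((((LinearMap.BilinForm.pi fun _ : Fin m ↦ -e8Form).prod (hyperbolicSum 2)).prod
          ((-(2 * d : ℤ)) • LinearMap.mul ℤ ℤ))),
        g.discriminantGroupCongr = LinearEquiv.refl ℤ _ ∧ g.IsOrientationPreserving ∧ g r.1 = s.1) =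
      if d % 4 = 1 then 2 else 1 := by
  obtain ⟨-, heB, huB⟩ := isSymm_isEven_isUnimodular_pi_neg_e8Form_prod_hyperbolicSum_two m
  exact natCard_quot_stable_isometryEquiv_isOrientationPreserving_apply_self_eq_neg_two d huB heB hd
    (twoHyperbolicPairs_pi_neg_e8Form_prod_hyperbolicSum_two m)

/-- **Prop. 2.4 (ii) for `L_{2d}^{(m)}`, `O⁺`-orbits**: two `O⁺(L_{2d}^{(m)})`-orbits of `(−2)`-vectors if `d ≡ 1 (mod 4)`, one
otherwise. [cite: GritsenkoHulekSankaran2008Proportionality, Prop. 2.4 (ii)] -/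
theorem natCard_quot_isometryEquiv_isOrientationPreserving_latticeL2dm_apply_self_eq_neg_two (hd : 0 < d) :
    Nat.card (Quot fun r s : {r : ((Fin m → Fin 8 → ℤ) × ((Fin 2 → ℤ) × (Fin 2 → ℤ))) × ℤ //
        (((LinearMap.BilinForm.pi fun _ : Fin m ↦ -e8Form).prod (hyperbolicSum 2)).prod
          ((-(2 * d : ℤ)) • LinearMap.mul ℤ ℤ)) r r = -2} ↦
      ∃ g : ((((LinearMap.BilinForm.pi fun _ : Fin m ↦ -e8Form).prod (hyperbolicSum 2)).prod
          ((-(2 * d : ℤ)) • LinearMap.mul ℤ ℤ))).IsometryEquiv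
          ((((LinearMap.BilinForm.pi fun _ : Fin m ↦ -e8Form).prod (hyperbolicSum 2)).prod
          ((-(2 * d : ℤ)) • LinearMap.mul ℤ ℤ))), g.IsOrientationPreserving ∧ g r.1 = s.1) =
      if d % 4 = 1 then 2 else 1 := by
  obtain ⟨-, heB, huB⟩ := isSymm_isEven_isUnimodular_pi_neg_e8Form_prod_hyperbolicSum_two m
  exact natCard_quot_isometryEquiv_isOrientationPreserving_apply_self_eq_neg_two d huB heB hd
    (twoHyperbolicPairs_pi_neg_e8Form_prod_hyperbolicSum_two m)

/-- **Prop. 2.4 (iv) for `L_{2d}^{(m)}`, `div(r) = 2d`, `Õ⁺`-orbits**: `2^{ρ(d)}` orbits.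
[cite: GritsenkoHulekSankaran2008Proportionality, Prop. 2.4 (iv)] -/
theorem natCard_quot_stable_isometryEquiv_isOrientationPreserving_latticeL2dm_neg_twoMul_of_divisor_twoMul
    (hd : 0 < d) :
    Nat.card (Quot fun r s : {r : ((Fin m → Fin 8 → ℤ) × ((Fin 2 → ℤ) × (Fin 2 → ℤ))) × ℤ //
        (((LinearMap.BilinForm.pi fun _ : Fin m ↦ -e8Form).prod (hyperbolicSum 2)).prod
          ((-(2 * d : ℤ)) • LinearMap.mul ℤ ℤ)) r r = -(2 * d : ℤ) ∧
        (∀ z, (2 * d : ℤ) ∣ (((LinearMap.BilinForm.pi fun _ : Fin m ↦ -e8Form).prod (hyperbolicSum 2)).prod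
          ((-(2 * d : ℤ)) • LinearMap.mul ℤ ℤ)) r z) ∧
        ∃ r', (((LinearMap.BilinForm.pi fun _ : Fin m ↦ -e8Form).prod (hyperbolicSum 2)).prod
          ((-(2 * d : ℤ)) • LinearMap.mul ℤ ℤ)) r r' = 2 * d} ↦
      ∃ g : ((((LinearMap.BilinForm.pi fun _ : Fin m ↦ -e8Form).prod (hyperbolicSum 2)).prod
          ((-(2 * d : ℤ)) • LinearMap.mul ℤ ℤ))).IsometryEquiv
          ((((LinearMap.BilinForm.pi fun _ : Fin m ↦ -e8Form).prod (hyperbolicSum 2)).prod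
          ((-(2 * d : ℤ)) • LinearMap.mul ℤ ℤ))),
        g.discriminantGroupCongr = LinearEquiv.refl ℤ _ ∧ g.IsOrientationPreserving ∧ g r.1 = s.1) =
      2 ^ d.primeFactors.card := by
  obtain ⟨-, heB, huB⟩ := isSymm_isEven_isUnimodular_pi_neg_e8Form_prod_hyperbolicSum_two m
  exact natCard_quot_stable_isometryEquiv_isOrientationPreserving_neg_twoMul_of_divisor_twoMul d huB heB hd
    (twoHyperbolicPairs_pi_neg_e8Form_prod_hyperbolicSum_two m)

/-- **Prop. 2.4 (iv) for `L_{2d}^{(m)}`, `div(r) = d`, `Õ⁺`-orbits**: `#{x mod d : x² = 1}` orbits.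
[cite: GritsenkoHulekSankaran2008Proportionality, Prop. 2.4 (iv)] -/
theorem natCard_quot_stable_isometryEquiv_isOrientationPreserving_latticeL2dm_neg_twoMul_of_divisor (hd : 0 < d) :
    Nat.card (Quot fun r s : {r : ((Fin m → Fin 8 → ℤ) × ((Fin 2 → ℤ) × (Fin 2 → ℤ))) × ℤ //
        (((LinearMap.BilinForm.pi fun _ : Fin m ↦ -e8Form).prod (hyperbolicSum 2)).prod
          ((-(2 * d : ℤ)) • LinearMap.mul ℤ ℤ)) r r = -(2 * d : ℤ) ∧
        (∀ z, (d : ℤ) ∣ (((LinearMap.BilinForm.pi fun _ : Fin m ↦ -e8Form).prod (hyperbolicSum 2)).prod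
          ((-(2 * d : ℤ)) • LinearMap.mul ℤ ℤ)) r z) ∧
        ∃ r', (((LinearMap.BilinForm.pi fun _ : Fin m ↦ -e8Form).prod (hyperbolicSum 2)).prod
          ((-(2 * d : ℤ)) • LinearMap.mul ℤ ℤ)) r r' = d} ↦
      ∃ g : ((((LinearMap.BilinForm.pi fun _ : Fin m ↦ -e8Form).prod (hyperbolicSum 2)).prod
          ((-(2 * d : ℤ)) • LinearMap.mul ℤ ℤ))).IsometryEquiv
          ((((LinearMap.BilinForm.pi fun _ : Fin m ↦ -e8Form).prod (hyperbolicSum 2)).prod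
          ((-(2 * d : ℤ)) • LinearMap.mul ℤ ℤ))),
        g.discriminantGroupCongr = LinearEquiv.refl ℤ _ ∧ g.IsOrientationPreserving ∧ g r.1 = s.1) =
      Nat.card {u : ZMod d // u ^ 2 = 1} := by
  obtain ⟨-, heB, huB⟩ := isSymm_isEven_isUnimodular_pi_neg_e8Form_prod_hyperbolicSum_two m
  exact natCard_quot_stable_isometryEquiv_isOrientationPreserving_neg_twoMul_of_divisor d huB heB hd
    (twoHyperbolicPairs_pi_neg_e8Form_prod_hyperbolicSum_two m)

end Model

end Literature.Topology.FourManifolds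

end
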